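import Summits.ResolutionOfSingularities.ResolutionOfSingularities.Theorems.PurelyInseparableDim4IsolatedPowerIdeal
import HarnessLib
import HarnessLib.Audit.Tags

/-!
# Purely inseparable four-folds — at a light merged-ledger state, isolation lives in the level-2 cofactor
# (cell `res-dim4-pi`, K2(p) lane, slice B brick K18)

[OURS · counted 0 · cell `res-dim4-pi` · K2(p) lane holder res-dim4-p-12 g3's brick by signature (bus
2026-08-29 00:12Z, SLICE-B-ARCH v1.4 §9 K7-prep), seat res-dim4-p-9 g3.]  Nothing here proves K2(p),
`NoIsolatedTrap p p` or resolution of singularities in dimension ≥ 4 / characteristic `p`; K16–K19 are the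
bookkeeping of the light regime (I-4-7 class C∞) only.

A merged double ledger `u·G = S·(x_a x_{b′}) + T·h^d` (`u(0) ≠ 0`, `h ∈ 𝔪₀`, `d ≥ 3`) whose level-2 cofactor
`S` vanishes on the axis `{x_a = x_{b′} = h = 0}` (i.e. `S ∈ (x_a, x_{b′}, h)`) puts `u·G` in `(x_a, x_{b′}, h)³`,
hence `u·x^r G ∈ (x_a, x_{b′}, h)^{r_a + r_{b′} + 3}`; so for `q ≤ r_a + r_{b′} + 3` the state `x^r·G` is NOT an
isolated `q`-fold point (K1 `IsolatedBand.not_isIsolated_of_unit_mul_mem_span_triple_pow`):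
**`not_isIsolated_of_cofactor_mem_span_triple`**, contrapositive **`cofactor_not_mem_span_triple_of_isIsolated`**
— «at a LIGHT state (`r_a + r_{b′} = p − 3`, `d ≥ 3`) isolation forces `S ≢ 0` on the axis» (idea-4 C∞:
`Ã₀(0,0,u) ≠ 0`).

bears_on: LADDER-RESOLUTION:D157-DOOR2 (res-dim4-pi · K2(p) · slice B · K18).  Supports
stmt-ResolutionOfSingularities-16155 (helper).
-/

set_option linter.dupNamespace false -- mandated namespace of this single-conjunct summit

noncomputable section

namespace Summit.ResolutionOfSingularities.ResolutionOfSingularities.Theorems.PIDim4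

namespace IsolatedBand

open MvPolynomial Finset
open Literature.AlgebraicGeometry.Resolution

variable {K : Type} [Field K]

/-- **A merged ledger with cofactor on the axis puts `u·G` in the cube of the axis ideal**:
`u·G = S·(x_a x_{b′}) + T·h^d`, `S ∈ (x_a, x_{b′}, h)`, `d ≥ 3` ⇒ `u·G ∈ (x_a, x_{b′}, h)³`. [folklore] -/
theorem unit_mul_mem_span_triple_pow_three {d : ℕ} {a b' : Fin 4} {G h u S T : MvPolynomial (Fin 4) K}
    (hG : u * G = S * (X a * X b') + T * h ^ d) (hd : 3 ≤ d)
    (hS : S ∈ Ideal.span {(X a : MvPolynomial (Fin 4) K), X b', h}) :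
    u * G ∈ (Ideal.span {(X a : MvPolynomial (Fin 4) K), X b', h}) ^ 3 := by
  set I : Ideal (MvPolynomial (Fin 4) K) := Ideal.span {(X a : MvPolynomial (Fin 4) K), X b', h} with hI
  have hXa : (X a : MvPolynomial (Fin 4) K) ∈ I := Ideal.subset_span (by simp)
  have hXb : (X b' : MvPolynomial (Fin 4) K) ∈ I := Ideal.subset_span (by simp)
  have hh : h ∈ I := Ideal.subset_span (by simp)
  rw [hG]
  refine add_mem ?_ ?_
  · rw [show (3 : ℕ) = 1 + (1 + 1) by rfl, pow_add, pow_add, pow_one]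
    exact Ideal.mul_mem_mul hS (Ideal.mul_mem_mul hXa hXb)
  · exact Ideal.mul_mem_left _ _ (Ideal.pow_le_pow_right hd (Ideal.pow_mem_pow hh d))

/-- **LEVEL-2 ISOLATION WITNESS** (brick K18): if `u(0) ≠ 0`, `h ∈ 𝔪₀`, `a ≠ b′`,
`u·G = S·(x_a x_{b′}) + T·h^d` with `d ≥ 3` and the cofactor `S ∈ (x_a, x_{b′}, h)`, then for every boundary
`r` with `q ≤ r_a + r_{b′} + 3` the state `x^r · G` is NOT an isolated `q`-fold point (the axis
`{x_a = x_{b′} = h = 0}` is `q`-fold: weight `r_a + r_{b′}` plus order `3`). [folklore] -/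
theorem not_isIsolated_of_cofactor_mem_span_triple {q d : ℕ} {a b' : Fin 4} (hab : a ≠ b')
    {G h u S T : MvPolynomial (Fin 4) K} (hh : h ∈ originIdeal K) (hu : MvPolynomial.eval (0 : Fin 4 → K) u ≠ 0)
    (hG : u * G = S * (X a * X b') + T * h ^ d) (hd : 3 ≤ d)
    (hS : S ∈ Ideal.span {(X a : MvPolynomial (Fin 4) K), X b', h}) (r : Fin 4 →₀ ℕ)
    (hq : q ≤ r a + r b' + 3) : ¬ IsIsolated q (monomial r 1 * G) := by
  refine not_isIsolated_of_unit_mul_mem_span_triple_pow hu (IsolatedScope.X_mem_originIdeal a)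
    (IsolatedScope.X_mem_originIdeal b') hh (Ideal.pow_le_pow_right hq ?_)
  rw [mul_left_comm, pow_add]
  exact Ideal.mul_mem_mul (monomial_mem_span_pow hab h r) (unit_mul_mem_span_triple_pow_three hG hd hS)

/-- **Contrapositive**: at an isolated state `x^r · G` with a merged ledger `u·G = S·(x_a x_{b′}) + T·h^d`
(`u(0) ≠ 0`, `h ∈ 𝔪₀`, `d ≥ 3`) and `q ≤ r_a + r_{b′} + 3` — the LIGHT case `r_a + r_{b′} = p − 3` — the level-2
cofactor does NOT vanish on the axis: `S ∉ (x_a, x_{b′}, h)` (idea-4 C∞: `Ã₀(0,0,u) ≠ 0`). [folklore] -/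
theorem cofactor_not_mem_span_triple_of_isIsolated {q d : ℕ} {a b' : Fin 4} (hab : a ≠ b')
    {G h u S T : MvPolynomial (Fin 4) K} (hh : h ∈ originIdeal K) (hu : MvPolynomial.eval (0 : Fin 4 → K) u ≠ 0)
    (hG : u * G = S * (X a * X b') + T * h ^ d) (hd : 3 ≤ d) (r : Fin 4 →₀ ℕ) (hq : q ≤ r a + r b' + 3)
    (hiso : IsIsolated q (monomial r 1 * G)) :
    S ∉ Ideal.span {(X a : MvPolynomial (Fin 4) K), X b', h} :=
  fun hS => not_isIsolated_of_cofactor_mem_span_triple hab hh hu hG hd hS r hq hiso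

end IsolatedBand

end Summit.ResolutionOfSingularities.ResolutionOfSingularities.Theorems.PIDim4
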